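import Summits.Ventures.YMGap.RobustBall.StateSmoothBall
import Summits.Ventures.YMGap.RobustBall.StateDerivativeOnBallS
import HarnessLib

/-!
# Venture YMGap, track ROBUST-BALL (Y2) — TIER 2, «C-SMOOTH-BALL» (iv-S): THE PAIR DOOR — THE STATE IS `C^∞` ALONG EVERY DIRECTION OF FINITE
# EXPONENTIALLY DIAMETER-WEIGHTED LOAD, FOR EVERY MEMBER OF THE WEIGHTED BALL, ALL ORDERS AT ONCE

HONEST FRAMING. WHAT THIS IS: a venture file (cell `pub-ymgap`, track Y2 ROBUST-BALL, seat rb-p1, theorems only), the pair-door instance of the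
door-agnostic core `StateSmoothBall` (the endpoint of the ladder `StateDerivativeOnBallS` `C¹` → `StateSecondDerivativeS` `C²` → `StateThirdDerivativeS`
`C³`).  Member `W ∈ Ball(a, Λ, t)`, direction `V ∈ Ball(a_V, Λ_V, t)` with Frobenius-Lipschitz witnesses `lipV_X` of finite EXPONENTIALLY
DIAMETER-WEIGHTED LOAD `Σ'_{X ∋ e} e^{t·dia X} Σ_y lipV_X y ≤ L_d` (`dia ≥ 0` any diameter majorant of the supports), `a + s₀ a_V ≤ a'`, `Λ + s₀ Λ_V ≤ Λ'`,
pair door `ρ' < 1` at `(a', Λ', t)`, `t > 0`, ANY selection `ν(s) ∈ 𝒢(W + sV)` on `|s| ≤ s₀`, `F` bounded measurable local Frobenius-Lipschitz,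
`V^c_X := V_X − V_X(1)`, `u_{n+1} = Cumulants.trunc`:
* `pairDoor_responseData` — the three inputs of the core on the segment: covariance decay with `C_cov = 2(2√N)²` at rate `t`
  (`abs_cov_le_of_isLipBound_S` for the member `W + sV ∈ Ball(a', Λ', t)`), the first-order Feynman–Hellmann formula
  (`StateDerivativeOnBallS.hasDerivAt_and_continuousOn_direction_S`) and the summable susceptibility series (`summable_abs_cov_direction_S`);
* ★★★ `hasDerivAt_truncSum_direction_S` — `d/ds Σ'_q u_{n+1}(F; V^c_q …)_{ν(s)} = −Σ'_{q'} u_{n+2}(F; V^c_{q'} …)_{ν(s)}` at every `|s| < s₀`;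
* ★★★ `iteratedDeriv_integral_direction_S` — `(d/ds)ⁿ ∫ F dν(s) = (−1)ⁿ Σ'_{q : Fin n → Finset (links)} u_{n+1}(F; V^c_{q 0}; …; V^c_{q(n−1)})_{ν(s)}`
  (`Λ_F ≠ ∅`), the series being absolutely convergent with `Σ' |u_{n+1}| ≤ A_n Z_nⁿ` (`summable_trunc_direction_S`);
* ★★★ `contDiffOn_infty_integral_direction_S` — `s ↦ ∫ F dν(s)` IS `ContDiffOn ℝ ∞` ON `(−s₀, s₀)`: THE STATE MAP IS `C^∞` ALONG EVERY SUCH DIRECTION,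
  FOR EVERY MEMBER OF THE BALL AND EVERY DLR SELECTION.
WHAT THIS IS NOT: analyticity (the constants grow super-factorially in the order); one-sided Dobrushin-comparison constants at lattice strong
coupling; nothing about the continuum limit or a Clay-sense mass gap.
-/

noncomputable section

open MeasureTheory Function Finset ProbabilityTheory Real Filter Topology
open scoped NNReal ContDiff
open Literature.Probability.LatticeModels
open Literature.Probability.LatticeModels.DobrushinMetric
open Literature.MathematicalPhysics.QuantumLattice
open Literature.MathematicalPhysics.QuantumFieldTheory hiding ZdEdge
open Summit.Ventures.YMGap.Cumulants

namespace Summit.Ventures.YMGap.RobustBall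

variable {d N : ℕ}

section SUN

variable {W V : Potential (ZdEdge d) (Matrix.specialUnitaryGroup (Fin N) ℂ)}

/-- **The pair door supplies the three inputs of the door-agnostic core on the whole segment.**  Member `W ∈ Ball(a, Λ, t)`, direction
`V ∈ Ball(a_V, Λ_V, t)` with Lipschitz witnesses of exponentially diameter-weighted load `≤ L_d` (`dia ≥ 0`), room inside the pair door at `(a', Λ', t)`,
`t > 0`, any selection `ν(s) ∈ 𝒢(W + sV)` on `|s| ≤ s₀`: (i) every `ν(s)` is a probability measure; (ii) covariance decay with `C_cov = 2(2√N)²` at rate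
`t`; (iii) the first-order Feynman–Hellmann formula along `V`; (iv) summable susceptibility series. -/
theorem pairDoor_responseData (hd : 1 ≤ d) (hN : 1 ≤ N) {β b c v a' Λ' t : ℝ}
    (hc : 0 ≤ c) (hv : 0 ≤ v) (hb : |β| * (2 * ((d : ℝ) - 1)) ≤ b)
    (hP : ∀ B : Matrix (Fin N) (Fin N) ℂ, matrixOpNorm B ≤ b →
      ∀ (ψ : Matrix.specialUnitaryGroup (Fin N) ℂ → ℝ) (M : ℝ), 0 ≤ M →
        (∀ x y, |ψ x - ψ y| ≤ M * suFrobDist x y) →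
        Var[ψ; (haarProbability (Matrix.specialUnitaryGroup (Fin N) ℂ)).tilted
          fun g => (N : ℝ) * ((g : Matrix (Fin N) (Fin N) ℂ) * B).trace.re] ≤ c * M ^ 2)
    (hVB : ∀ B : Matrix (Fin N) (Fin N) ℂ, matrixOpNorm B ≤ b → ∀ Δ : Matrix (Fin N) (Fin N) ℂ,
      Var[fun g : Matrix.specialUnitaryGroup (Fin N) ℂ =>
          (N : ℝ) * ((g : Matrix (Fin N) (Fin N) ℂ) * Δ).trace.re;
        (haarProbability (Matrix.specialUnitaryGroup (Fin N) ℂ)).tilted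
          fun g => (N : ℝ) * ((g : Matrix (Fin N) (Fin N) ℂ) * B).trace.re] ≤ v * frobNorm Δ ^ 2)
    (ht : 0 < t) (hρ : 6 * ((d : ℝ) - 1) * |β| * (exp a' * exp t * Real.sqrt (c * v)) + exp (a' / 2) * Real.sqrt c * Λ' < 1)
    {a Λ aV ΛV s₀ : ℝ} (hW : MemBallZdS a Λ t W) (hV : MemBallZdS aV ΛV t V) (haV : 0 ≤ aV) (hΛV : 0 ≤ ΛV)
    (hs₀ : 0 < s₀) (ha' : a + s₀ * aV ≤ a') (hΛ' : Λ + s₀ * ΛV ≤ Λ')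
    {lipV : Finset (ZdEdge d) → ZdEdge d → ℝ} (hlipV : ∀ X, IsLipBound suFrobDist (V X) (lipV X))
    {dia : Finset (ZdEdge d) → ℝ} (hdia0 : ∀ X, 0 ≤ dia X) {Ld : ℝ}
    (hLs : ∀ e, Summable fun X : Finset (ZdEdge d) => (if e ∈ X then exp (t * dia X) * ∑ y ∈ X, lipV X y else 0))
    (hL : ∀ e, ∑' X : Finset (ZdEdge d), (if e ∈ X then exp (t * dia X) * ∑ y ∈ X, lipV X y else 0) ≤ Ld)
    {ν : ℝ → Measure (LGConfig d (Matrix.specialUnitaryGroup (Fin N) ℂ))}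
    (hν : ∀ s ∈ Set.Icc (-s₀) s₀, ν s ∈ perturbedGibbsMeasuresS (d := d) (fundamentalRep (Fin N)) (N * β) (W + s • V)) :
    (∀ s ∈ Set.Icc (-s₀) s₀, IsProbabilityMeasure (ν s)) ∧
    (∀ s ∈ Set.Icc (-s₀) s₀,
      ∀ (f g : LGConfig d (Matrix.specialUnitaryGroup (Fin N) ℂ) → ℝ) (Δf Δg : Finset (ZdEdge d)) (Mf Mg : ℝ) (δf δg : ZdEdge d → ℝ),
      Measurable f → DependsOn f (↑Δf : Set (ZdEdge d)) → (∀ σ, |f σ| ≤ Mf) → IsLipBound suFrobDist f δf →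
      Measurable g → DependsOn g (↑Δg : Set (ZdEdge d)) → (∀ σ, |g σ| ≤ Mg) → IsLipBound suFrobDist g δg →
        |cov[f, g; ν s]| ≤ 2 * (2 * Real.sqrt N) ^ 2 * (∑ y ∈ Δg, δg y) * (∑ y ∈ Δf, δf y) * exp (-(t * setDistEdges Δf Δg))) ∧
    (∀ (g : LGConfig d (Matrix.specialUnitaryGroup (Fin N) ℂ) → ℝ) (Δ : Finset (ZdEdge d)) (M : ℝ) (δ : ZdEdge d → ℝ),
      Measurable g → DependsOn g (↑Δ : Set (ZdEdge d)) → (∀ σ, |g σ| ≤ M) → IsLipBound suFrobDist g δ →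
      ∀ s ∈ Set.Ioo (-s₀) s₀, HasDerivAt (fun s => ∫ σ, g σ ∂(ν s)) (-(∑' X : Finset (ZdEdge d), cov[g, V X; ν s])) s) ∧
    (∀ s ∈ Set.Icc (-s₀) s₀, ∀ (g : LGConfig d (Matrix.specialUnitaryGroup (Fin N) ℂ) → ℝ) (Δ : Finset (ZdEdge d)) (M : ℝ)
      (δ : ZdEdge d → ℝ), Measurable g → DependsOn g (↑Δ : Set (ZdEdge d)) → (∀ σ, |g σ| ≤ M) → IsLipBound suFrobDist g δ →
      Summable fun X : Finset (ZdEdge d) => cov[g, V X; ν s]) := by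
  classical
  have habs : ∀ {s}, s ∈ Set.Icc (-s₀) s₀ → |s| ≤ s₀ := fun hs => abs_le.2 ⟨by linarith [hs.1], hs.2⟩
  have hmem : ∀ s ∈ Set.Icc (-s₀) s₀, MemBallZdS a' Λ' t (W + s • V) := fun s hs => by
    have hm := memBallZdS_add_smul_indicator hW hV haV hΛV ha' hΛ' (habs hs) Set.univ
    rwa [Set.indicator_univ] at hm
  have hplain := fun e => plainLoad_of_expLoad (fun X y => (hlipV X).nonneg y) (fun X => mul_nonneg ht.le (hdia0 X)) hLs hL e
  have hVb : ∀ X, ∃ C, ∀ U, |V X U| ≤ C := fun X => exists_bound_of_continuous (hV.continuous X)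
  have hVm : ∀ X, Measurable (V X) := fun X => (hV.continuous X).measurable
  refine ⟨fun s hs => (show IsGibbsMeasure _ _ from hν s hs).isProbabilityMeasure, fun s hs => ?_, ?_, fun s hs => ?_⟩
  · intro f g Δf Δg Mf Mg δf δg hfm hfdep hMf hδf hgm hgdep hMg hδg
    obtain ⟨BW, hBW⟩ := (hmem s hs).summable
    obtain ⟨osc, lip, ℓ, hosc, hlipW, hoscs, hosca, hlips, hℓ, hℓs, hℓt⟩ := (hmem s hs).loads
    exact abs_cov_le_of_isLipBound_S hd hN hc hv hb hP hVB hBW (hmem s hs).continuous (hmem s hs).dependsOn hosc hoscs hosca hlipW hlips hℓ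
      ht.le hℓs hℓt hρ (hν s hs) hfm hfdep hMf hδf hgm hgdep hMg hδg
  · intro g Δ M δ hgm hgdep hM hδ
    exact (hasDerivAt_and_continuousOn_direction_S hd hN hc hv hb hP hVB ht hρ hW hV haV hΛV hs₀ ha' hΛ' hlipV
      (fun e => (hplain e).1) (fun e => (hplain e).2) hν hgm hgdep hM hδ).1
  · intro g Δ M δ hgm hgdep hM hδ
    obtain ⟨BW, hBW⟩ := (hmem s hs).summable
    obtain ⟨osc, lip, ℓ, hosc, hlipW, hoscs, hosca, hlips, hℓ, hℓs, hℓt⟩ := (hmem s hs).loads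
    exact (summable_abs_cov_direction_S hd hN hc hv hb hP hVB hBW (hmem s hs).continuous (hmem s hs).dependsOn hosc hoscs hosca hlipW hlips
      hℓ ht hℓs hℓt hρ (hν s hs) hgm hgdep hM hδ hVm hV.dependsOn hVb hlipV (fun e => (hplain e).1) (fun e => (hplain e).2)).1.of_abs

/-- ★★ **ABSOLUTE CONVERGENCE OF THE RESPONSE SERIES OF EVERY ORDER ALONG THE LINE.**  Under the pair-door hypotheses, for every `|s| ≤ s₀` and every
`n` (`Λ_F ≠ ∅`): `q ↦ u_{n+1}(F; V^c_q …)_{ν(s)}` is summable over `Fin n → Finset (links)` with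
`Σ' |u_{n+1}| ≤ cumBound(n+1)(1 + 2(2√N)²)(M_F + Σδ_F) Z_nⁿ`, `Z_n = (2√N+1) L_d #Λ_F d ((1+r_n)/(1−r_n))^d`, `r_n = e^{−(t/n²)/d}`. -/
theorem summable_trunc_direction_S (hd : 1 ≤ d) (hN : 1 ≤ N) {β b c v a' Λ' t : ℝ}
    (hc : 0 ≤ c) (hv : 0 ≤ v) (hb : |β| * (2 * ((d : ℝ) - 1)) ≤ b)
    (hP : ∀ B : Matrix (Fin N) (Fin N) ℂ, matrixOpNorm B ≤ b →
      ∀ (ψ : Matrix.specialUnitaryGroup (Fin N) ℂ → ℝ) (M : ℝ), 0 ≤ M →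
        (∀ x y, |ψ x - ψ y| ≤ M * suFrobDist x y) →
        Var[ψ; (haarProbability (Matrix.specialUnitaryGroup (Fin N) ℂ)).tilted
          fun g => (N : ℝ) * ((g : Matrix (Fin N) (Fin N) ℂ) * B).trace.re] ≤ c * M ^ 2)
    (hVB : ∀ B : Matrix (Fin N) (Fin N) ℂ, matrixOpNorm B ≤ b → ∀ Δ : Matrix (Fin N) (Fin N) ℂ,
      Var[fun g : Matrix.specialUnitaryGroup (Fin N) ℂ =>
          (N : ℝ) * ((g : Matrix (Fin N) (Fin N) ℂ) * Δ).trace.re;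
        (haarProbability (Matrix.specialUnitaryGroup (Fin N) ℂ)).tilted
          fun g => (N : ℝ) * ((g : Matrix (Fin N) (Fin N) ℂ) * B).trace.re] ≤ v * frobNorm Δ ^ 2)
    (ht : 0 < t) (hρ : 6 * ((d : ℝ) - 1) * |β| * (exp a' * exp t * Real.sqrt (c * v)) + exp (a' / 2) * Real.sqrt c * Λ' < 1)
    {a Λ aV ΛV s₀ : ℝ} (hW : MemBallZdS a Λ t W) (hV : MemBallZdS aV ΛV t V) (haV : 0 ≤ aV) (hΛV : 0 ≤ ΛV)
    (hs₀ : 0 < s₀) (ha' : a + s₀ * aV ≤ a') (hΛ' : Λ + s₀ * ΛV ≤ Λ')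
    {lipV : Finset (ZdEdge d) → ZdEdge d → ℝ} (hlipV : ∀ X, IsLipBound suFrobDist (V X) (lipV X))
    {dia : Finset (ZdEdge d) → ℝ} (hdia0 : ∀ X, 0 ≤ dia X) (hdia : ∀ X, ∀ y ∈ X, ∀ z ∈ X, ‖y.1 - z.1‖ ≤ dia X) {Ld : ℝ} (hLd0 : 0 ≤ Ld)
    (hLs : ∀ e, Summable fun X : Finset (ZdEdge d) => (if e ∈ X then exp (t * dia X) * ∑ y ∈ X, lipV X y else 0))
    (hL : ∀ e, ∑' X : Finset (ZdEdge d), (if e ∈ X then exp (t * dia X) * ∑ y ∈ X, lipV X y else 0) ≤ Ld)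
    {ν : ℝ → Measure (LGConfig d (Matrix.specialUnitaryGroup (Fin N) ℂ))}
    (hν : ∀ s ∈ Set.Icc (-s₀) s₀, ν s ∈ perturbedGibbsMeasuresS (d := d) (fundamentalRep (Fin N)) (N * β) (W + s • V))
    {F : LGConfig d (Matrix.specialUnitaryGroup (Fin N) ℂ) → ℝ} (hFm : Measurable F) {ΛF : Finset (ZdEdge d)} (hΛF : ΛF.Nonempty)
    (hFdep : DependsOn F (↑ΛF : Set (ZdEdge d))) {MF : ℝ} (hMF : ∀ σ, |F σ| ≤ MF) {δF : ZdEdge d → ℝ}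
    (hδF : IsLipBound suFrobDist F δF) (n : ℕ) {s : ℝ} (hs : s ∈ Set.Icc (-s₀) s₀) :
    Summable (fun q : Fin n → Finset (ZdEdge d) => trunc (ν s) F (fun X σ => V X σ - V X 1) q) ∧
      ∑' q : Fin n → Finset (ZdEdge d), |trunc (ν s) F (fun X σ => V X σ - V X 1) q| ≤
        cumBound (n + 1) * (1 + 2 * (2 * Real.sqrt N) ^ 2) * (MF + ∑ y ∈ ΛF, δF y) *
          ((2 * Real.sqrt N + 1) * Ld * (ΛF.card * (d * ((1 + exp (-(t / n ^ 2 / d))) / (1 - exp (-(t / n ^ 2 / d)))) ^ d))) ^ n := by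
  obtain ⟨hprob, hCov, -, -⟩ := pairDoor_responseData hd hN hc hv hb hP hVB ht hρ hW hV haV hΛV hs₀ ha' hΛ' hlipV hdia0 hLs hL hν
  haveI := hprob s hs
  exact summable_trunc_of_covDecay hd (by positivity) ht (hCov s hs) hFm hΛF hFdep hMF hδF (fun X => (hV.continuous X).measurable)
    hV.dependsOn hlipV hdia0 hdia hLd0 hLs hL n

/-- ★★★ **THE ORDER-`n` RESPONSE SERIES ALONG A LINE OF THE BALL IS DIFFERENTIABLE, WITH DERIVATIVE MINUS THE ORDER-`(n+1)` SERIES** (pair door):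
for every `n` and every `|s| < s₀`,
`HasDerivAt (s ↦ Σ'_{q : Fin n → Finset} u_{n+1}(F; V^c_q …)_{ν(s)}) (−Σ'_{q' : Fin (n+1) → Finset} u_{n+2}(F; V^c_{q'} …)_{ν(s)}) s`. -/
theorem hasDerivAt_truncSum_direction_S (hd : 1 ≤ d) (hN : 1 ≤ N) {β b c v a' Λ' t : ℝ}
    (hc : 0 ≤ c) (hv : 0 ≤ v) (hb : |β| * (2 * ((d : ℝ) - 1)) ≤ b)
    (hP : ∀ B : Matrix (Fin N) (Fin N) ℂ, matrixOpNorm B ≤ b →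
      ∀ (ψ : Matrix.specialUnitaryGroup (Fin N) ℂ → ℝ) (M : ℝ), 0 ≤ M →
        (∀ x y, |ψ x - ψ y| ≤ M * suFrobDist x y) →
        Var[ψ; (haarProbability (Matrix.specialUnitaryGroup (Fin N) ℂ)).tilted
          fun g => (N : ℝ) * ((g : Matrix (Fin N) (Fin N) ℂ) * B).trace.re] ≤ c * M ^ 2)
    (hVB : ∀ B : Matrix (Fin N) (Fin N) ℂ, matrixOpNorm B ≤ b → ∀ Δ : Matrix (Fin N) (Fin N) ℂ,
      Var[fun g : Matrix.specialUnitaryGroup (Fin N) ℂ =>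
          (N : ℝ) * ((g : Matrix (Fin N) (Fin N) ℂ) * Δ).trace.re;
        (haarProbability (Matrix.specialUnitaryGroup (Fin N) ℂ)).tilted
          fun g => (N : ℝ) * ((g : Matrix (Fin N) (Fin N) ℂ) * B).trace.re] ≤ v * frobNorm Δ ^ 2)
    (ht : 0 < t) (hρ : 6 * ((d : ℝ) - 1) * |β| * (exp a' * exp t * Real.sqrt (c * v)) + exp (a' / 2) * Real.sqrt c * Λ' < 1)
    {a Λ aV ΛV s₀ : ℝ} (hW : MemBallZdS a Λ t W) (hV : MemBallZdS aV ΛV t V) (haV : 0 ≤ aV) (hΛV : 0 ≤ ΛV)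
    (hs₀ : 0 < s₀) (ha' : a + s₀ * aV ≤ a') (hΛ' : Λ + s₀ * ΛV ≤ Λ')
    {lipV : Finset (ZdEdge d) → ZdEdge d → ℝ} (hlipV : ∀ X, IsLipBound suFrobDist (V X) (lipV X))
    {dia : Finset (ZdEdge d) → ℝ} (hdia0 : ∀ X, 0 ≤ dia X) (hdia : ∀ X, ∀ y ∈ X, ∀ z ∈ X, ‖y.1 - z.1‖ ≤ dia X) {Ld : ℝ} (hLd0 : 0 ≤ Ld)
    (hLs : ∀ e, Summable fun X : Finset (ZdEdge d) => (if e ∈ X then exp (t * dia X) * ∑ y ∈ X, lipV X y else 0))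
    (hL : ∀ e, ∑' X : Finset (ZdEdge d), (if e ∈ X then exp (t * dia X) * ∑ y ∈ X, lipV X y else 0) ≤ Ld)
    {ν : ℝ → Measure (LGConfig d (Matrix.specialUnitaryGroup (Fin N) ℂ))}
    (hν : ∀ s ∈ Set.Icc (-s₀) s₀, ν s ∈ perturbedGibbsMeasuresS (d := d) (fundamentalRep (Fin N)) (N * β) (W + s • V))
    {F : LGConfig d (Matrix.specialUnitaryGroup (Fin N) ℂ) → ℝ} (hFm : Measurable F) {ΛF : Finset (ZdEdge d)} (hΛF : ΛF.Nonempty)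
    (hFdep : DependsOn F (↑ΛF : Set (ZdEdge d))) {MF : ℝ} (hMF : ∀ σ, |F σ| ≤ MF) {δF : ZdEdge d → ℝ}
    (hδF : IsLipBound suFrobDist F δF) (n : ℕ) :
    ∀ s ∈ Set.Ioo (-s₀) s₀, HasDerivAt (fun s => ∑' q : Fin n → Finset (ZdEdge d), trunc (ν s) F (fun X σ => V X σ - V X 1) q)
      (-(∑' q' : Fin (n + 1) → Finset (ZdEdge d), trunc (ν s) F (fun X σ => V X σ - V X 1) q')) s := by
  obtain ⟨hprob, hCov, hC1, hSum⟩ := pairDoor_responseData hd hN hc hv hb hP hVB ht hρ hW hV haV hΛV hs₀ ha' hΛ' hlipV hdia0 hLs hL hν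
  exact hasDerivAt_truncSum_of_response hd (by positivity) ht hprob hCov (fun X => (hV.continuous X).measurable) hV.dependsOn
    (fun X => exists_bound_of_continuous (hV.continuous X)) hlipV hC1 hSum hdia0 hdia hLd0 hLs hL hFm hΛF hFdep hMF hδF n

/-- ★★★ **THE `n`-TH DERIVATIVE OF THE STATE ALONG THE LINE IS `(−1)ⁿ` TIMES THE ORDER-`n` RESPONSE SERIES** (pair door, `Λ_F ≠ ∅`): for every `n`
and every `|s| < s₀`, `iteratedDeriv n (s ↦ ∫ F dν(s)) s = (−1)ⁿ Σ'_{q : Fin n → Finset (links)} u_{n+1}(F; V^c_{q 0}; …; V^c_{q(n−1)})_{ν(s)}`. -/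
theorem iteratedDeriv_integral_direction_S (hd : 1 ≤ d) (hN : 1 ≤ N) {β b c v a' Λ' t : ℝ}
    (hc : 0 ≤ c) (hv : 0 ≤ v) (hb : |β| * (2 * ((d : ℝ) - 1)) ≤ b)
    (hP : ∀ B : Matrix (Fin N) (Fin N) ℂ, matrixOpNorm B ≤ b →
      ∀ (ψ : Matrix.specialUnitaryGroup (Fin N) ℂ → ℝ) (M : ℝ), 0 ≤ M →
        (∀ x y, |ψ x - ψ y| ≤ M * suFrobDist x y) →
        Var[ψ; (haarProbability (Matrix.specialUnitaryGroup (Fin N) ℂ)).tilted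
          fun g => (N : ℝ) * ((g : Matrix (Fin N) (Fin N) ℂ) * B).trace.re] ≤ c * M ^ 2)
    (hVB : ∀ B : Matrix (Fin N) (Fin N) ℂ, matrixOpNorm B ≤ b → ∀ Δ : Matrix (Fin N) (Fin N) ℂ,
      Var[fun g : Matrix.specialUnitaryGroup (Fin N) ℂ =>
          (N : ℝ) * ((g : Matrix (Fin N) (Fin N) ℂ) * Δ).trace.re;
        (haarProbability (Matrix.specialUnitaryGroup (Fin N) ℂ)).tilted
          fun g => (N : ℝ) * ((g : Matrix (Fin N) (Fin N) ℂ) * B).trace.re] ≤ v * frobNorm Δ ^ 2)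
    (ht : 0 < t) (hρ : 6 * ((d : ℝ) - 1) * |β| * (exp a' * exp t * Real.sqrt (c * v)) + exp (a' / 2) * Real.sqrt c * Λ' < 1)
    {a Λ aV ΛV s₀ : ℝ} (hW : MemBallZdS a Λ t W) (hV : MemBallZdS aV ΛV t V) (haV : 0 ≤ aV) (hΛV : 0 ≤ ΛV)
    (hs₀ : 0 < s₀) (ha' : a + s₀ * aV ≤ a') (hΛ' : Λ + s₀ * ΛV ≤ Λ')
    {lipV : Finset (ZdEdge d) → ZdEdge d → ℝ} (hlipV : ∀ X, IsLipBound suFrobDist (V X) (lipV X))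
    {dia : Finset (ZdEdge d) → ℝ} (hdia0 : ∀ X, 0 ≤ dia X) (hdia : ∀ X, ∀ y ∈ X, ∀ z ∈ X, ‖y.1 - z.1‖ ≤ dia X) {Ld : ℝ} (hLd0 : 0 ≤ Ld)
    (hLs : ∀ e, Summable fun X : Finset (ZdEdge d) => (if e ∈ X then exp (t * dia X) * ∑ y ∈ X, lipV X y else 0))
    (hL : ∀ e, ∑' X : Finset (ZdEdge d), (if e ∈ X then exp (t * dia X) * ∑ y ∈ X, lipV X y else 0) ≤ Ld)
    {ν : ℝ → Measure (LGConfig d (Matrix.specialUnitaryGroup (Fin N) ℂ))}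
    (hν : ∀ s ∈ Set.Icc (-s₀) s₀, ν s ∈ perturbedGibbsMeasuresS (d := d) (fundamentalRep (Fin N)) (N * β) (W + s • V))
    {F : LGConfig d (Matrix.specialUnitaryGroup (Fin N) ℂ) → ℝ} (hFm : Measurable F) {ΛF : Finset (ZdEdge d)} (hΛF : ΛF.Nonempty)
    (hFdep : DependsOn F (↑ΛF : Set (ZdEdge d))) {MF : ℝ} (hMF : ∀ σ, |F σ| ≤ MF) {δF : ZdEdge d → ℝ}
    (hδF : IsLipBound suFrobDist F δF) (n : ℕ) :
    ∀ s ∈ Set.Ioo (-s₀) s₀, iteratedDeriv n (fun s => ∫ σ, F σ ∂(ν s)) s =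
      (-1) ^ n * ∑' q : Fin n → Finset (ZdEdge d), trunc (ν s) F (fun X σ => V X σ - V X 1) q := by
  obtain ⟨hprob, hCov, hC1, hSum⟩ := pairDoor_responseData hd hN hc hv hb hP hVB ht hρ hW hV haV hΛV hs₀ ha' hΛ' hlipV hdia0 hLs hL hν
  exact iteratedDeriv_integral_of_response hd (by positivity) ht hprob hCov (fun X => (hV.continuous X).measurable) hV.dependsOn
    (fun X => exists_bound_of_continuous (hV.continuous X)) hlipV hC1 hSum hdia0 hdia hLd0 hLs hL hFm hΛF hFdep hMF hδF n

/-- ★★★ **THE STATE IS `C^∞` ALONG EVERY DIRECTION OF FINITE EXPONENTIALLY DIAMETER-WEIGHTED LOAD, FOR EVERY MEMBER OF THE BALL.**  Member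
`W ∈ Ball(a, Λ, t)`, direction `V ∈ Ball(a_V, Λ_V, t)` with Lipschitz witnesses of exponentially diameter-weighted load `≤ L_d`, room
`a + s₀ a_V ≤ a'`, `Λ + s₀ Λ_V ≤ Λ'` inside the pair door at `(a', Λ', t)`, `t > 0`; ANY DLR selection `ν(s) ∈ 𝒢(W + sV)` on `|s| ≤ s₀`; `F` bounded
measurable local Frobenius-Lipschitz.  Then `s ↦ ∫ F dν(s)` is `ContDiffOn ℝ ∞` on `(−s₀, s₀)`.  `C^∞`, NOT analytic. -/
theorem contDiffOn_infty_integral_direction_S (hd : 1 ≤ d) (hN : 1 ≤ N) {β b c v a' Λ' t : ℝ}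
    (hc : 0 ≤ c) (hv : 0 ≤ v) (hb : |β| * (2 * ((d : ℝ) - 1)) ≤ b)
    (hP : ∀ B : Matrix (Fin N) (Fin N) ℂ, matrixOpNorm B ≤ b →
      ∀ (ψ : Matrix.specialUnitaryGroup (Fin N) ℂ → ℝ) (M : ℝ), 0 ≤ M →
        (∀ x y, |ψ x - ψ y| ≤ M * suFrobDist x y) →
        Var[ψ; (haarProbability (Matrix.specialUnitaryGroup (Fin N) ℂ)).tilted
          fun g => (N : ℝ) * ((g : Matrix (Fin N) (Fin N) ℂ) * B).trace.re] ≤ c * M ^ 2)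
    (hVB : ∀ B : Matrix (Fin N) (Fin N) ℂ, matrixOpNorm B ≤ b → ∀ Δ : Matrix (Fin N) (Fin N) ℂ,
      Var[fun g : Matrix.specialUnitaryGroup (Fin N) ℂ =>
          (N : ℝ) * ((g : Matrix (Fin N) (Fin N) ℂ) * Δ).trace.re;
        (haarProbability (Matrix.specialUnitaryGroup (Fin N) ℂ)).tilted
          fun g => (N : ℝ) * ((g : Matrix (Fin N) (Fin N) ℂ) * B).trace.re] ≤ v * frobNorm Δ ^ 2)
    (ht : 0 < t) (hρ : 6 * ((d : ℝ) - 1) * |β| * (exp a' * exp t * Real.sqrt (c * v)) + exp (a' / 2) * Real.sqrt c * Λ' < 1)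
    {a Λ aV ΛV s₀ : ℝ} (hW : MemBallZdS a Λ t W) (hV : MemBallZdS aV ΛV t V) (haV : 0 ≤ aV) (hΛV : 0 ≤ ΛV)
    (hs₀ : 0 < s₀) (ha' : a + s₀ * aV ≤ a') (hΛ' : Λ + s₀ * ΛV ≤ Λ')
    {lipV : Finset (ZdEdge d) → ZdEdge d → ℝ} (hlipV : ∀ X, IsLipBound suFrobDist (V X) (lipV X))
    {dia : Finset (ZdEdge d) → ℝ} (hdia0 : ∀ X, 0 ≤ dia X) (hdia : ∀ X, ∀ y ∈ X, ∀ z ∈ X, ‖y.1 - z.1‖ ≤ dia X) {Ld : ℝ} (hLd0 : 0 ≤ Ld)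
    (hLs : ∀ e, Summable fun X : Finset (ZdEdge d) => (if e ∈ X then exp (t * dia X) * ∑ y ∈ X, lipV X y else 0))
    (hL : ∀ e, ∑' X : Finset (ZdEdge d), (if e ∈ X then exp (t * dia X) * ∑ y ∈ X, lipV X y else 0) ≤ Ld)
    {ν : ℝ → Measure (LGConfig d (Matrix.specialUnitaryGroup (Fin N) ℂ))}
    (hν : ∀ s ∈ Set.Icc (-s₀) s₀, ν s ∈ perturbedGibbsMeasuresS (d := d) (fundamentalRep (Fin N)) (N * β) (W + s • V))
    {F : LGConfig d (Matrix.specialUnitaryGroup (Fin N) ℂ) → ℝ} (hFm : Measurable F) {ΛF : Finset (ZdEdge d)}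
    (hFdep : DependsOn F (↑ΛF : Set (ZdEdge d))) {MF : ℝ} (hMF : ∀ σ, |F σ| ≤ MF) {δF : ZdEdge d → ℝ}
    (hδF : IsLipBound suFrobDist F δF) :
    ContDiffOn ℝ ∞ (fun s => ∫ σ, F σ ∂(ν s)) (Set.Ioo (-s₀) s₀) := by
  obtain ⟨hprob, hCov, hC1, hSum⟩ := pairDoor_responseData hd hN hc hv hb hP hVB ht hρ hW hV haV hΛV hs₀ ha' hΛ' hlipV hdia0 hLs hL hν
  exact contDiffOn_infty_integral_of_response hd (by positivity) ht hprob hCov (fun X => (hV.continuous X).measurable) hV.dependsOn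
    (fun X => exists_bound_of_continuous (hV.continuous X)) hlipV hC1 hSum hdia0 hdia hLd0 hLs hL hFm hFdep hMF hδF

end SUN

end Summit.Ventures.YMGap.RobustBall

end
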